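import Literature.NumberTheory.Sieve.LargestPrimeFactorCubicSawtoothSums
import Literature.NumberTheory.Sieve.VinogradovExpSumTools
import Mathlib.Data.Int.CardIntervalMod
import HarnessLib

/-!
# Heath-Brown 2001 (PLMS), Lemma 10, per-modulus step: `S(q,k) − U²/q` as sawtooth sums over an
# arithmetic progression, bounded by geometric sums

Topic `Literature/NumberTheory/Sieve`; a PROVED analytic layer (definitions with bodies, no named
facts) under the named fact `Irving2015_largestPrimeFactor_cubic` (`LargestPrimeFactorCubic.lean`), the
second input (after `…RootPairs`) of Heath-Brown's **Lemma 10** (main-term programme, Lemma 7).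
Source: D. R. Heath-Brown, *The largest prime factor of `X³ + 2`*, Proc. London Math. Soc. (3) 82
(2001) 554–596, §7 pp. 23–25 of the held text.  Lemma 10 (p. 23) estimates

  `S(R) = S(R; A, B, U) = #{a, b : A < a ≤ A + U, B < b ≤ B + U, R ∣ a − b∛2}`

against `U²/N(R)`; with `k ≡ ∛2 (mod R)`, `ρ(R) = 1`, "`R ∣ u − v∛2` … is equivalent to
`N(R) ∣ u − vk`" (p. 24), so in root language `S(R) = S(q, k) = #{a, b : q ∣ a − bk}`.  Heath-Brown
expands in additive characters modulo `N(R)` ((7.2): `S(R) = (U² + O(U))/N(R) + O(N(R)⁻¹ ∑ min{U,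
N(R)/|c|} min{U, N(R)/|d|})`); we follow the one-variable form of the same Fourier argument: for
each `b` the `a`-count is EXACT in terms of the sawtooth `ψ(x) = {x} − ½`,

  `#{A < a ≤ A+U : a ≡ bk (mod q)} = U/q + ψ((A − bk)/q) − ψ((A+U − bk)/q)`   (`card_Ioc_filter_modEq_eq_saw`),

so `S(q,k) − U²/q = ∑_b ψ((A − bk)/q) − ψ((A+U−bk)/q)` (`Scount_sub_eq`), and the sums
`∑_{B<b≤B+U} ψ((t − bk)/q)` are bounded through the parallel seat's Vaaler/Fejér inequality
`abs_sum_saw_le` ((3.4) of the paper) by geometric sums `|∑_b e(mbk/q)| ≤ min{U, 1/(2‖mk/q‖)}`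
(`norm_sum_Ioc_e_ap_le`, Nathanson Lemma 4.7 = the tree's `geomBound`):

  **`abs_Scount_sub_le`**: `|S(q,k) − U²/q| ≤ 2[(1/π) ∑_{ν≤V} G_U(νk/q)/ν + c_V ∑_{|d|≤5(2V+1)} G_U(dk/q)]`,
  `G_U(y) = min{U, 1/(2‖y‖)}`, `c_V = 3(2 + log(2V+1))/(2V+1)`, any `V ≥ 1`.

The summation over `(q, k)` (with `…RootPairs.card_rootPairs_dvd_le`) is the sequel `…Lemma10`.

## References

* D. R. Heath-Brown, *The largest prime factor of `X³ + 2`*, Proc. London Math. Soc. (3) 82 (2001)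
  554–596, §7, Lemma 10 and (7.2), pp. 23–24. [`HeathBrown2001LargestPrimeFactorCubic`]
* M. B. Nathanson, *Additive Number Theory: The Classical Bases*, GTM 164 (1996), Lemma 4.7.

## Mathlib / tree search

Tree: `LargestPrimeFactorCubic.abs_sum_saw_le` (`…SawtoothSums`), `Vinogradov.geomBound`,
`norm_sum_Ioc_fourierChar_le_geomBound`, `geomBound_neg`, `geomBound_zero`, `geomBound_nonneg`,
`norm_fourierChar` (`VinogradovExpSumTools`), `LFunctions.AFE.saw`, `saw_def`.
Mathlib: `Nat.Ioc_filter_modEq_card`, `Rat.floor_cast`, `Int.floor_add_fract`, `Rat.cast_fract`,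
`AddChar.map_add_eq_mul`, `Nat.modEq_iff_dvd`.
-/

noncomputable section

open Finset Real
open scoped FourierTransform

namespace Literature.NumberTheory.Sieve.HeathBrown2001

open Literature.NumberTheory.LFunctions.AFE (saw saw_def)
open Literature.NumberTheory.Sieve.Vinogradov (distInt geomBound geomBound_neg geomBound_zero
  geomBound_nonneg geomBound_le norm_sum_Ioc_fourierChar_le_geomBound norm_fourierChar)
open Literature.NumberTheory.Sieve.LargestPrimeFactorCubic (abs_sum_saw_le)

/-! ### The exact count in a progression through the sawtooth -/

/-- **`#{A < a ≤ A+U : a ≡ v (mod q)} = U/q + ψ((A − v)/q) − ψ((A + U − v)/q)`** (`q ≥ 1`), the exact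
form of "`#𝒜 = X/N + ψ − ψ`" (cf. (3.2) of the paper). [cite: HeathBrown2001LargestPrimeFactorCubic, §3 (3.2)] -/
theorem card_Ioc_filter_modEq_eq_saw {q : ℕ} (hq : 0 < q) (A U v : ℕ) :
    (#((Ioc A (A + U)).filter fun a : ℕ => a ≡ v [MOD q]) : ℝ) =
      (U : ℝ) / q + saw (((A : ℝ) - v) / q) - saw (((A : ℝ) + U - v) / q) := by
  have hZ := Nat.Ioc_filter_modEq_card A (A + U) hq v
  set n := #((Ioc A (A + U)).filter fun a : ℕ => a ≡ v [MOD q]) with hn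
  set u : ℚ := (((A + U : ℕ) : ℚ) - v) / q with hu
  set w : ℚ := ((A : ℚ) - v) / q with hw
  have hq' : (0 : ℚ) < q := by exact_mod_cast hq
  have hwu : w ≤ u := by
    rw [hu, hw]; push_cast
    exact div_le_div_of_nonneg_right (by linarith [(Nat.cast_nonneg U : (0 : ℚ) ≤ U)]) hq'.le
  have hmax : max (⌊u⌋ - ⌊w⌋) 0 = ⌊u⌋ - ⌊w⌋ := max_eq_left (sub_nonneg.2 (Int.floor_mono hwu))
  rw [hmax] at hZ
  -- pass to `ℝ`
  have hnR : (n : ℝ) = ((⌊u⌋ : ℤ) : ℝ) - ((⌊w⌋ : ℤ) : ℝ) := by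
    have : ((n : ℤ) : ℝ) = (((⌊u⌋ - ⌊w⌋ : ℤ)) : ℝ) := by rw [hZ]
    push_cast at this ⊢
    exact this
  have hfu : ((⌊u⌋ : ℤ) : ℝ) = ((u : ℚ) : ℝ) - Int.fract ((u : ℚ) : ℝ) := by
    rw [← Rat.floor_cast (α := ℝ) u]; linarith [Int.floor_add_fract ((u : ℚ) : ℝ)]
  have hfw : ((⌊w⌋ : ℤ) : ℝ) = ((w : ℚ) : ℝ) - Int.fract ((w : ℚ) : ℝ) := by
    rw [← Rat.floor_cast (α := ℝ) w]; linarith [Int.floor_add_fract ((w : ℚ) : ℝ)]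
  have huR : ((u : ℚ) : ℝ) = ((A : ℝ) + U - v) / q := by rw [hu]; push_cast; ring
  have hwR : ((w : ℚ) : ℝ) = ((A : ℝ) - v) / q := by rw [hw]; push_cast; ring
  rw [hnR, hfu, hfw, huR, hwR, saw_def, saw_def]
  field_simp
  ring

/-! ### The count `S(q, k)` -/

/-- `S(q, k; A, B, U) = #{A < a ≤ A+U, B < b ≤ B+U : q ∣ a − bk}` (Heath-Brown's `S(R; A, B, U)` with
`k ≡ ∛2 (mod R)`). [cite: HeathBrown2001LargestPrimeFactorCubic, Lemma 10 p. 23] -/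
def Scount (q k A B U : ℕ) : ℕ :=
  #((Ioc A (A + U) ×ˢ Ioc B (B + U)).filter fun ab : ℕ × ℕ => (q : ℤ) ∣ (ab.1 : ℤ) - ab.2 * k)

/-- Fibring `S(q,k)` over `b`. [folklore] -/
theorem Scount_eq_sum (q k A B U : ℕ) :
    (Scount q k A B U : ℝ) =
      ∑ b ∈ Ioc B (B + U), (#((Ioc A (A + U)).filter fun a : ℕ => a ≡ b * k [MOD q]) : ℝ) := by
  classical
  have hiff : ∀ a b : ℕ, ((q : ℤ) ∣ (a : ℤ) - b * k) ↔ a ≡ b * k [MOD q] := by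
    intro a b
    rw [Nat.modEq_iff_dvd, ← dvd_neg, neg_sub]
    push_cast
    exact Iff.rfl
  unfold Scount
  rw [card_eq_sum_ones, sum_filter, sum_product_right]
  push_cast
  refine sum_congr rfl fun b _ => ?_
  rw [card_eq_sum_ones, sum_filter]
  push_cast
  refine sum_congr rfl fun a _ => ?_
  simp only [hiff]

/-- **`S(q,k) − U²/q = ∑_b ψ((A − bk)/q) − ψ((A+U−bk)/q)`** (`q ≥ 1`).
[cite: HeathBrown2001LargestPrimeFactorCubic, §7 (7.2)] -/
theorem Scount_sub_eq {q : ℕ} (hq : 0 < q) (k A B U : ℕ) :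
    (Scount q k A B U : ℝ) - (U : ℝ) ^ 2 / q =
      ∑ b ∈ Ioc B (B + U), (saw (((A : ℝ) - b * k) / q) - saw (((A : ℝ) + U - b * k) / q)) := by
  rw [Scount_eq_sum]
  have h : ∀ b ∈ Ioc B (B + U), (#((Ioc A (A + U)).filter fun a : ℕ => a ≡ b * k [MOD q]) : ℝ) =
      (U : ℝ) / q + (saw (((A : ℝ) - b * k) / q) - saw (((A : ℝ) + U - b * k) / q)) := by
    intro b _
    rw [card_Ioc_filter_modEq_eq_saw hq A U (b * k)]
    push_cast
    ring
  rw [sum_congr rfl h, sum_add_distrib, sum_const, Nat.card_Ioc, nsmul_eq_mul]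
  have : ((B + U - B : ℕ) : ℝ) = U := by rw [Nat.add_sub_cancel_left]
  rw [this]
  ring

/-! ### Geometric sums along the progression -/

/-- `|∑_{B<b≤B+U} e(m(t − bk)/q)| ≤ min{U, 1/(2‖mk/q‖)}`. [cite: HeathBrown2001LargestPrimeFactorCubic, §7 (7.2) (min{U, N(R)/|c|})] -/
theorem norm_sum_Ioc_e_ap_le (B U : ℕ) (m t k q : ℝ) :
    ‖∑ b ∈ Ioc B (B + U), (𝐞 (m * ((t - b * k) / q)) : ℂ)‖ ≤ geomBound U (m * k / q) := by
  have h : ∀ b : ℕ, (𝐞 (m * ((t - b * k) / q)) : ℂ) =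
      (𝐞 (m * t / q) : ℂ) * 𝐞 ((b : ℝ) * (-(m * k / q))) := by
    intro b
    rw [show m * ((t - b * k) / q) = m * t / q + (b : ℝ) * (-(m * k / q)) by ring,
      AddChar.map_add_eq_mul, Circle.coe_mul]
  rw [sum_congr rfl (fun b _ => h b), ← mul_sum, norm_mul, norm_fourierChar, one_mul, ← geomBound_neg]
  exact norm_sum_Ioc_fourierChar_le_geomBound _ (by rw [Nat.add_sub_cancel_left])

/-- The coefficient `c_V = 3(2 + log(2V+1))/(2V+1)` of the smoothed error in `abs_sum_saw_le`. [folklore] -/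
def cV (V : ℕ) : ℝ := 3 * (2 + Real.log (2 * V + 1)) / (2 * V + 1)

/-- `c_V ≥ 0`. [folklore] -/
theorem cV_nonneg (V : ℕ) : 0 ≤ cV V := by
  unfold cV
  have : 0 ≤ Real.log (2 * V + 1) := Real.log_nonneg (by have := (Nat.cast_nonneg V : (0:ℝ) ≤ V); linarith)
  positivity

/-- The geometric-sum majorant of a sawtooth sum along the progression:
`M(q,k) = (1/π) ∑_{ν=1}^{V} G_U(νk/q)/ν + c_V ∑_{d=−5(2V+1)}^{5(2V+1)} G_U(dk/q)`. [folklore] -/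
def sawMajorant (V U : ℕ) (k q : ℝ) : ℝ :=
  (1 / π) * ∑ ν ∈ Icc 1 V, geomBound U ((ν : ℝ) * k / q) / ν +
    cV V * ∑ d ∈ Icc (-((5 * (2 * V + 1) : ℕ) : ℤ)) (5 * (2 * V + 1) : ℕ), geomBound U ((d : ℝ) * k / q)

/-- `M(q,k) ≥ 0`. [folklore] -/
theorem sawMajorant_nonneg (V U : ℕ) (k q : ℝ) : 0 ≤ sawMajorant V U k q := by
  unfold sawMajorant
  have hG : ∀ y : ℝ, 0 ≤ geomBound U y := fun y => geomBound_nonneg (Nat.cast_nonneg U) y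
  refine add_nonneg (mul_nonneg (by positivity) (sum_nonneg fun ν _ => div_nonneg (hG _) (Nat.cast_nonneg _)))
    (mul_nonneg (cV_nonneg V) (sum_nonneg fun d _ => hG _))

/-- **Sawtooth sums along a progression**: `|∑_{B<b≤B+U} ψ((t − bk)/q)| ≤ M(q,k)` for any `V ≥ 1`
(the parallel seat's `abs_sum_saw_le` with the geometric-sum bound).
[cite: HeathBrown2001LargestPrimeFactorCubic, §3 (3.4) and §7 (7.2)] -/
theorem abs_sum_saw_ap_le {V : ℕ} (hV : 1 ≤ V) (B U : ℕ) (t k q : ℝ) :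
    |∑ b ∈ Ioc B (B + U), saw ((t - b * k) / q)| ≤ sawMajorant V U k q := by
  have h := abs_sum_saw_le (Ioc B (B + U)) (fun b : ℕ => (t - b * k) / q) hV
  refine h.trans ?_
  unfold sawMajorant cV
  gcongr with ν hν d hd
  · exact norm_sum_Ioc_e_ap_le B U ν t k q |>.trans_eq (by ring_nf)
  · have : 0 ≤ Real.log (2 * V + 1) := Real.log_nonneg (by have := (Nat.cast_nonneg V : (0:ℝ) ≤ V); linarith)
    positivity
  · exact norm_sum_Ioc_e_ap_le B U d t k q |>.trans_eq (by ring_nf)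

/-- **`|S(q,k) − U²/q| ≤ 2 M(q,k)`** for `q ≥ 1`, `V ≥ 1`.
[cite: HeathBrown2001LargestPrimeFactorCubic, §7 (7.2)] -/
theorem abs_Scount_sub_le {q V : ℕ} (hq : 0 < q) (hV : 1 ≤ V) (k A B U : ℕ) :
    |(Scount q k A B U : ℝ) - (U : ℝ) ^ 2 / q| ≤ 2 * sawMajorant V U k q := by
  rw [Scount_sub_eq hq, sum_sub_distrib]
  have h1 := abs_sum_saw_ap_le hV B U (A : ℝ) k q
  have h2 := abs_sum_saw_ap_le hV B U ((A : ℝ) + U) k q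
  calc |∑ b ∈ Ioc B (B + U), saw (((A : ℝ) - b * k) / q) - ∑ b ∈ Ioc B (B + U), saw (((A : ℝ) + U - b * k) / q)|
      ≤ |∑ b ∈ Ioc B (B + U), saw (((A : ℝ) - b * k) / q)| + |∑ b ∈ Ioc B (B + U), saw (((A : ℝ) + U - b * k) / q)| :=
        abs_sub _ _
    _ ≤ sawMajorant V U k q + sawMajorant V U k q := add_le_add h1 h2
    _ = 2 * sawMajorant V U k q := by ring

end Literature.NumberTheory.Sieve.HeathBrown2001
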